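import Summits.ResolutionOfSingularities.ResolutionOfSingularities.Theorems.WildConesCampaignW46NarrowRunsBound
import Summits.ResolutionOfSingularities.ResolutionOfSingularities.Theorems.WildConesCampaignW46ClassicalMuDrop
import Summits.ResolutionOfSingularities.ResolutionOfSingularities.Theorems.WildConesCampaignW46AtomGermTjurina
import HarnessLib

/-!
# [OURS · L1 W4.6, rung (i) WITH A NUMBER in EVERY dimension — brick 21] EFFECTIVE forced termination of route
# `WildCones`' point-blow-up dynamics: every isolated multiplicity-`p` run from `c₀` has at most `μ(c₀) + 1` states —
# EVERY prime `p`, EVERY `n ≥ 1`, every perfect field; and the Loewy bound `𝔪^μ ≤ (∂a)`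

Cell res-hironaka (LADDER-RESOLUTION rung L, D-0089), slot W4.6, seat res-L1-s46-pv-2 (gen 4). Host: route
`WildCones`, crux `ClassicalRegimes` (stmt-ResolutionOfSingularities-16884), `--supports … --as helper`.

HONEST FRAMING. Everything here is OURS: theorems about route `WildCones`' typed coefficient calculus
(`Theorems/WildConesClassicalRegimesDefs.lean`), assembled from the tree's proofs of the cruxes `ClassicalRegimes`
(Milnor drop, `classicalRegimes_exit_le_mu`, p480678), `ConeExit` and `NarrowRunsDie` (made effective in brick 20,
`NarrowRunsBound.false_of_isol_multP_le'`, p534251). NOTHING here is a statement of H. Hironaka's manuscript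
[Hironaka2017]; no FACT-LIST premise. AI review is weaker than expert review.

## What is proved

* `AtomGerm.maximalIdeal_pow_le_of_le_sup`, `AtomGerm.maximalIdeal_pow_finrank_le` — **Loewy bound**: for an ideal `J` of
  `κ⟦u₁,…,uₙ⟧` of finite colength `μ = dim_κ κ⟦u⟧/J`, `𝔪^μ ≤ J` (Nakayama through Krull: `𝔪^k ≤ J + 𝔪^{k+1} ⇒ 𝔪^k ≤ J`,
  brick 3's `mem_of_forall_mem_sup_pow`; the images of the `𝔪^k` in `κ⟦u⟧/J` strictly decrease until they stabilise,
  which happens by `k = μ`). Feeds brick 20 with `D = μ(c₀)`.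
* `EffectiveTermination.le_mu_of_isol_multP` — **if the states `run c₀ i t j`, `j ≤ L`, are all isolated of multiplicity
  `p`, then `L ≤ μ(c₀)`** (`p` any prime, `n ≥ 1`, `κ` perfect): in the classical regimes `n ≤ 2 ∨ p = 2` by the Milnor
  drop; for `p` odd, `n ≥ 3` by the effective death of narrow runs with `𝔪^{μ(c₀)} ≤ jac c₀`.
* `EffectiveTermination.exists_exit_le_mu_succ` — the drop-in form `∃ m ≤ μ(c₀) + 1, ¬(Isol ∧ MultP)(run c₀ i t m)` of
  `classicalRegimes_exit_le_mu` WITHOUT the regime hypothesis `n ≤ 2 ∨ p = 2`.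
* `EffectiveTermination.effectiveIsolatedForcedTermination` — **the route's TARGET `IsolatedForcedTermination`
  (stmt-16343, = `FrobeniusClosing`'s, proved in the tree WITHOUT a number) WITH A NUMBER**: for every prime `p`, `n ≥ 1`,
  perfect `κ` of characteristic `p`, start `c₀` and words `i`, `t`, some state `m ≤ μ(c₀) + 1` of the point-blow-up
  dynamics of the height-one atom `z^p = a(u)` is not isolated of multiplicity `p` (the target itself follows by
  `fun … hall => let ⟨m, _, hm⟩ := exists_exit_le_mu_succ hp hn c₀ i t; hm (hall m)`, definitionally — not restated here,
  it is `WildCones.IsolatedForcedTermination_proof`).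

Not claimed: that `μ + 1` is sharp for `p` odd, `n ≥ 3` (the classical regimes give `μ`); nothing over imperfect fields.

References: p480678 (`classicalRegimes_exit_le_mu`), p534251 (brick 20), p500857 (brick 3, Krull form); the tree's
`NarrowRunsDie_proof` / `ConeExit_proof` / `WildCones.engine`; H. Hauser, S. Perlega, arXiv:1802.05010 §1 (the forced-cycle
question, here answered with a bound). [HauserPerlega2019] [folklore]
-/

noncomputable section

-- single-problem summit: the doubled namespace component `ResolutionOfSingularities` is forced
set_option linter.dupNamespace false

open scoped BigOperators Classical
open MvPowerSeries IsLocalRing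

namespace Summit.ResolutionOfSingularities.ResolutionOfSingularities.Theorems

/-! ## Loewy bound: `𝔪^μ ≤ J` for an ideal of colength `μ` in `κ⟦u⟧` -/

namespace CampaignW46.AtomGerm

variable {n : ℕ} {κ : Type} [Field κ]

/-- [OURS · L1 W4.6] **Nakayama through Krull**: in `κ⟦u₁,…,uₙ⟧`, `𝔪^k ≤ J + 𝔪^{k+1}` implies `𝔪^k ≤ J` (iterate to
`𝔪^k ≤ J + 𝔪^N` for all `N`, then `⋂_N (J + 𝔪^N) = J`, brick 3). [folklore] -/
theorem maximalIdeal_pow_le_of_le_sup (J : Ideal (MvPowerSeries (Fin n) κ)) (k : ℕ)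
    (h : maximalIdeal (MvPowerSeries (Fin n) κ) ^ k ≤ J ⊔ maximalIdeal (MvPowerSeries (Fin n) κ) ^ (k + 1)) :
    maximalIdeal (MvPowerSeries (Fin n) κ) ^ k ≤ J := by
  set 𝔪 := maximalIdeal (MvPowerSeries (Fin n) κ) with h𝔪
  have hiter : ∀ j, 𝔪 ^ k ≤ J ⊔ 𝔪 ^ (k + j) := by
    intro j
    induction j with
    | zero => rw [add_zero]; exact le_sup_right
    | succ j ih =>
      have h1 : 𝔪 * (J ⊔ 𝔪 ^ (k + j)) ≤ J ⊔ 𝔪 ^ (k + (j + 1)) := by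
        rw [Ideal.mul_sup]
        refine sup_le_sup Ideal.mul_le_left (le_of_eq ?_)
        rw [← pow_succ', show k + j + 1 = k + (j + 1) by omega]
      calc 𝔪 ^ k ≤ J ⊔ 𝔪 ^ (k + 1) := h
        _ = J ⊔ 𝔪 * 𝔪 ^ k := by rw [pow_succ']
        _ ≤ J ⊔ 𝔪 * (J ⊔ 𝔪 ^ (k + j)) := sup_le_sup_left (Ideal.mul_mono_right ih) _
        _ ≤ J ⊔ (J ⊔ 𝔪 ^ (k + (j + 1))) := sup_le_sup_left h1 _
        _ = J ⊔ 𝔪 ^ (k + (j + 1)) := by rw [← sup_assoc, sup_idem]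
  intro x hx
  refine mem_of_forall_mem_sup_pow fun N => ?_
  rcases le_or_gt N k with hNk | hNk
  · exact Ideal.mem_sup_right (Ideal.pow_le_pow_right hNk hx)
  · obtain ⟨j, rfl⟩ := Nat.exists_eq_add_of_lt hNk
    have := hiter (j + 1) hx
    rwa [show k + (j + 1) = k + j + 1 by omega] at this

/-- [OURS · L1 W4.6 — DICTIONARY; NOT a statement of the manuscript] **Loewy bound**: for an ideal `J` of `κ⟦u₁,…,uₙ⟧` of
finite colength `μ = dim_κ κ⟦u⟧/J`, `𝔪^μ ≤ J`. (The images of the `𝔪^k` in `κ⟦u⟧/J` form a decreasing chain of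
subspaces of a `μ`-dimensional space; a stationary step `k ≤ μ` exists, and there `𝔪^k ≤ J + 𝔪^{k+1}`, so `𝔪^k ≤ J`.)
In particular `𝔪^{μ(c)} ≤ jac c` for an isolated state `c` of route `WildCones`' calculus. [folklore] -/
theorem maximalIdeal_pow_finrank_le (J : Ideal (MvPowerSeries (Fin n) κ))
    [hJ : Module.Finite κ (MvPowerSeries (Fin n) κ ⧸ J)] :
    maximalIdeal (MvPowerSeries (Fin n) κ) ^ (Module.finrank κ (MvPowerSeries (Fin n) κ ⧸ J)) ≤ J := by
  set 𝔪 := maximalIdeal (MvPowerSeries (Fin n) κ) with h𝔪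
  set μ := Module.finrank κ (MvPowerSeries (Fin n) κ ⧸ J) with hμ
  -- the images of the powers of `𝔪` in `R/J`, as `κ`-subspaces
  let V : ℕ → Submodule κ (MvPowerSeries (Fin n) κ ⧸ J) := fun k =>
    ((𝔪 ^ k).map (Ideal.Quotient.mk J)).restrictScalars κ
  have hVanti : ∀ k, V (k + 1) ≤ V k := fun k x hx =>
    (Ideal.map_mono (Ideal.pow_le_pow_right (Nat.le_succ k)) : (𝔪 ^ (k + 1)).map (Ideal.Quotient.mk J) ≤
      (𝔪 ^ k).map (Ideal.Quotient.mk J)) hx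
  -- a stationary step forces `𝔪^k ≤ J`
  have hstab : ∀ k, V (k + 1) = V k → 𝔪 ^ k ≤ J := by
    intro k hk
    apply maximalIdeal_pow_le_of_le_sup J k
    have hk' : (𝔪 ^ (k + 1)).map (Ideal.Quotient.mk J) = (𝔪 ^ k).map (Ideal.Quotient.mk J) :=
      Submodule.restrictScalars_injective κ _ _ hk
    have h1 := Ideal.comap_map_of_surjective (Ideal.Quotient.mk J) Ideal.Quotient.mk_surjective (𝔪 ^ k)
    have h2 := Ideal.comap_map_of_surjective (Ideal.Quotient.mk J) Ideal.Quotient.mk_surjective (𝔪 ^ (k + 1))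
    rw [← RingHom.ker_eq_comap_bot, Ideal.mk_ker] at h1 h2
    calc 𝔪 ^ k ≤ 𝔪 ^ k ⊔ J := le_sup_left
      _ = Ideal.comap (Ideal.Quotient.mk J) ((𝔪 ^ (k + 1)).map (Ideal.Quotient.mk J)) := by rw [hk', h1]
      _ = 𝔪 ^ (k + 1) ⊔ J := h2
      _ = J ⊔ 𝔪 ^ (k + 1) := sup_comm _ _
  -- a strictly decreasing chain of subspaces of `R/J` has length `≤ μ`
  by_contra hcon
  have hstrict : ∀ k ≤ μ, V (k + 1) < V k := by
    intro k hk
    refine lt_of_le_of_ne (hVanti k) fun heq => hcon ?_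
    exact le_trans (Ideal.pow_le_pow_right hk) (hstab k heq)
  have hdim : ∀ k ≤ μ + 1, Module.finrank κ (V k) + k ≤ μ := by
    intro k
    induction k with
    | zero => intro _; simpa using Submodule.finrank_le (V 0)
    | succ k ih =>
      intro hk
      have h1 := ih (by omega)
      have h2 := Submodule.finrank_lt_finrank_of_lt (hstrict k (by omega))
      omega
  have := hdim (μ + 1) le_rfl
  omega

end CampaignW46.AtomGerm

/-! ## Effective forced termination of the coefficient calculus -/

namespace CampaignW46.EffectiveTermination

open WildCones
open CampaignW46.AtomGerm

variable {p n : ℕ} {κ : Type} [Field κ] [CharP κ p] [PerfectField κ]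

/-- [OURS · L1 W4.6 rung (i) WITH A NUMBER in EVERY dimension; replaces the role of Th. 16.13 p.87 l.25–28 («… but
FINITELY MANY times») of H. Hironaka's ms. (2017) for the point-blow-up dynamics of a height-one atom, read with a
NUMBER; NOT a statement of the manuscript] **Isolated multiplicity-`p` runs have at most `μ(c₀) + 1` states**: for every
prime `p`, `n ≥ 1`, perfect `κ` of characteristic `p`: if the states `run c₀ i t j`, `j ≤ L`, are all isolated of
multiplicity `p` then `L ≤ μ(c₀)`. (`n ≤ 2 ∨ p = 2`: the Milnor number drops at every step, p480678; `p` odd, `n ≥ 3`: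
brick 20 with the Loewy bound `𝔪^{μ(c₀)} ≤ jac c₀`.) [folklore] -/
theorem le_mu_of_isol_multP (hp : p.Prime) (hn : 0 < n) (c₀ : (Fin n → ℕ) → κ) (i : ℕ → Fin n) (t : ℕ → Fin n → κ)
    {L : ℕ} (hgood : ∀ j ≤ L, Isol p n κ (run p n κ c₀ i t j) ∧ MultP p n κ (run p n κ c₀ i t j)) :
    L ≤ mu p n κ c₀ := by
  by_cases hreg : n ≤ 2 ∨ p = 2
  · obtain ⟨m, hmμ, hbad⟩ := classicalRegimes_exit_le_mu hp hn hreg κ c₀ i t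
    have hLm : L < m := by
      by_contra hle
      exact hbad (hgood m (by omega))
    omega
  · have hp2 : p ≠ 2 := fun h => hreg (Or.inr h)
    have hn3 : 3 ≤ n := by omega
    haveI : Module.Finite κ (MvPowerSeries (Fin n) κ ⧸ jac p n κ c₀) := (hgood 0 (Nat.zero_le _)).1
    have hD : maximalIdeal (MvPowerSeries (Fin n) κ) ^ (mu p n κ c₀) ≤ jac p n κ c₀ :=
      maximalIdeal_pow_finrank_le (jac p n κ c₀)
    by_contra hlt
    push Not at hlt
    exact NarrowRunsBound.false_of_isol_multP_le' p hp hp2 hn3 c₀ hD i t fun m hm => hgood m (by omega)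

/-- [OURS · L1 W4.6 rung (i) WITH A NUMBER in EVERY dimension; NOT a statement of the manuscript] **Exit by stage
`μ(c₀) + 1`**: for every prime `p`, `n ≥ 1`, perfect `κ` of characteristic `p`, start `c₀` and words `i`, `t`, some state
`m ≤ μ(c₀) + 1` is not isolated of multiplicity `p` — the form of `WildCones.classicalRegimes_exit_le_mu` (p480678)
WITHOUT the regime hypothesis `n ≤ 2 ∨ p = 2` (at the price `μ ↦ μ + 1`). [folklore] -/
theorem exists_exit_le_mu_succ (hp : p.Prime) (hn : 0 < n) (c₀ : (Fin n → ℕ) → κ) (i : ℕ → Fin n)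
    (t : ℕ → Fin n → κ) :
    ∃ m ≤ mu p n κ c₀ + 1, ¬ (Isol p n κ (run p n κ c₀ i t m) ∧ MultP p n κ (run p n κ c₀ i t m)) := by
  by_contra h
  push Not at h
  have := le_mu_of_isol_multP hp hn c₀ i t (L := mu p n κ c₀ + 1) fun j hj => h j hj
  omega

omit [CharP κ p] [PerfectField κ] in
/-- [OURS · L1 W4.6 rung (i) WITH A NUMBER in EVERY dimension — route `WildCones`' TARGET `IsolatedForcedTermination`
(stmt-ResolutionOfSingularities-16343; proved in the tree without a number, `WildCones.IsolatedForcedTermination_proof`)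
WITH A NUMBER; replaces the role of Th. 16.13 p.87 l.25–28 of H. Hironaka's ms. (2017) for the height-one atom; NOT a
statement of the manuscript] **Effective isolated forced termination**: for every prime `p`, every `n ≥ 1`, every
perfect field `κ` of characteristic `p`, every start `c₀` and all words `i`, `t`, the point-blow-up dynamics of the atom
`z^p = a(u₁,…,uₙ)` leaves the isolated multiplicity-`p` locus by stage `μ(c₀) + 1 = dim_κ κ⟦u⟧/(∂a) + 1`. [folklore] -/
theorem effectiveIsolatedForcedTermination :
    ∀ (p : ℕ), p.Prime → ∀ (n : ℕ), 0 < n → ∀ (κ : Type) [Field κ] [CharP κ p] [PerfectField κ]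
      (c₀ : (Fin n → ℕ) → κ) (i : ℕ → Fin n) (t : ℕ → Fin n → κ),
      ∃ m ≤ mu p n κ c₀ + 1, ¬ (Isol p n κ (run p n κ c₀ i t m) ∧ MultP p n κ (run p n κ c₀ i t m)) :=
  fun _ hp _ hn _ _ _ _ c₀ i t => exists_exit_le_mu_succ hp hn c₀ i t

end CampaignW46.EffectiveTermination

end Summit.ResolutionOfSingularities.ResolutionOfSingularities.Theorems

end
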